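import Literature.MathematicalPhysics.QuantumFieldTheory.Balaban1983to89.B9Eq343CovariantResolventHolderAdjointRow
import Literature.MathematicalPhysics.QuantumFieldTheory.Balaban1983to89.B9Eq342ResolventGradLetterTower

/-!
# `Balaban1983to89.B9Eq343ResolventHolderRowTowerOfFlat` — T. Bałaban, *Propagators for lattice gauge theories in a background field*, Commun. Math. Phys. **99** (1985)
# 389–434 [Balaban1985BackgroundPropagators] Thm 3.1 (3.43) p. 398, SECOND MEMBER, FOR THE COVARIANT MASSIVE RESOLVENT ON THE MODEL: **the η-scale HÖLDER row with decay
# of `(Δ^η_U + 1)⁻¹D*_U` at the tower, `∃ αh Bh δh` BEFORE THE HEIGHT, MODULO ONE DISPLAYED FLAT LETTER `HflatT` (the two-point letter of `(L₀+1)⁻¹∂*` on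
# `T_{(L^{n+1}m)}` with the `cosh` weights — [B4] (1.9) at `A = 0`, NOT in the tree for general periods)** — the abstract Hölder bootstrap
# (`B9Eq343CovariantResolventHolderAdjointRow.holderAdjRow_covariantResolvent_half`) instantiated at `R(U)`, `R(U⁻¹)`, `t = ℓ = η⁻¹ = L^{n+1}`, rate
# `a = min(a⋆, κg∕(dL^{n+1}))`, its `Hgrad` letter INHABITED by `B9Eq342ResolventGradLetterTower.exists_gradLetter_resolvent` (closed), the `cosh` weight centred at the output
# site, block decay read off as in the value row

statement-level skeleton of published theorems with citation tags; proofs where landed; nothing here is a claim about the Yang–Mills mass gap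

CITATION HEADER (lean-in-tree rule).  Audit cell `pub-balaban`, sub-cell `t4`, BINDER row NE9; filed by NE9 crux-team LEAF PROVER 01 (`b2b-balaban-t4-ne9-formalise-leaf-01`,
gen 93; bears_on: R4/N22).  Source READ first-hand (`paper:balaban1985-cmp99-background-propagators`): p. 398 Thm 3.1 (3.43), p. 397 (3.40), (3.42), p. 394 (3.23).  COMPOSED
BY NAME from the imports and the value-row tower file's letters.  Nothing printed is a hypothesis except through `HflatT` (DISPLAYED, flat, free resolvent).

WHAT IS PROVED (sorry-free; proof lane — 0 `def`).
* **`exists_holderRow_resolvent_covDiv_of_flat`** — for `0 < β ≤ 1` and a flat constant `SH ≥ 0` with `HflatT`: `∃ αh Bh δh` such that on the model, for block-supported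
  bond data `‖f‖ ≤ F` and `d(x,x′) ≤ L^{n+1}`: `‖((Δ^η_U+1)⁻¹D*_Uf)(x′) − ((Δ^η_U+1)⁻¹D*_Uf)(x)‖ ≤ Bh·e^{−δh·d_m(Πx,v)}·(d(x,x′)∕L^{n+1})^β·F`.
HONEST SCOPE.  CONDITIONAL on `HflatT` (the located open analytic input of (HLaH)); the `G′_k`-step (HJ-3) and the docking into (HLaH)'s block remain (successor).  NOT summit
progress (cell pub-balaban: NE9 NOT PRINTED ∕ NOT PROVED; «NE9 ⇐ the named binders»; row WALLED ON A MODEL (O-NE9-1; #5 UNRULED); spine PROVED 0∕9; rung (B)+1 finite T⁴ —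
NOT infinite volume, NOT mass gap, NOT BetaPertH, NOT Clay).  HONEST DEPENDENCY (cell line): continuum YM on T⁴ ⇐ BetaPertH ∧ nine spine estimates (0/9 proved); BetaPertH ⇐
(D1) ∧ (D4) ∧ CAP+tail; G-an2-4 gates asym, D1 and NE2/3/4.  NEW file; nothing modified.  Net new unproved facts: 0 (the flat letter is a hypothesis, not a declaration).
-/

noncomputable section

open scoped InnerProductSpace ComplexConjugate BigOperators

namespace Literature.MathematicalPhysics.QuantumFieldTheory.Balaban1983to89.B9Eq343ResolventHolderRowTowerOfFlat

open B4Sect5Torus (TSite tdist tdist_nonneg)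
open B4TorusKernel.MultiPeriod (circAbs)
open B7Prop1Explicit (U1 mem_U1 norm_inv_sub_one_le)
open B9SectCLatticeCarrier (Bond bpos btgt shift unshift)
open B9Eq311L2Pairing (WL2)
open B11Eq103H1Complex (SiteL2K BondL2K covDerivL2K covDivL2K covLaplaceSiteK greenK)
open B9Eq310HessianOperator (adTransportW)
open B9Eq319QprimeTorus (fineP blockCoord)
open B9Eq315QTower (towerP towerP_apply UlevOf)
open B9Eq316TowerFlatIsOneStep (towerP_eq_fineP_pow siteCast)
open B9Eq324DeltaPrimeATower (laplacePrimeAk)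
open B9Eq342GreenPrimeSupBound (adTransportW_inv_adTransportW norm_adTransportW_eq norm_adTransportW_inv_eq)
open B9Eq384RemainderLetters (norm_adTransportW_sub_le)
open B9Eq373TransporterLipschitzLetters (norm_adTransportW_inv_sub_adTransportW_inv_le)
open B9Eq342GreenPrimeSupBoundDecayCosh (rate_explicit)
open B9Eq342GreenPrimeTowerSupBoundDecayCosh (exp_bigBlockDist_le_weight_site)
open B9Eq342CoshWeightSite (weight_site_centre weight_site_pos)
open B9Eq342CovariantResolventAdjointRowTower (sad_le_sixteen_mul)
open B9Eq343CovariantResolventHolderAdjointRow (holderAdjRow_covariantResolvent_half)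
open B9Eq342ResolventGradLetterTower (exists_gradLetter_resolvent)

/-- arithmetic of `κ ≤ ½` (outside the big context). [folklore] -/
private theorem kappa_le_half {c α d S ea : ℝ} (hc0 : 0 ≤ c) (hα : 0 ≤ α) (hα1 : α * (128 * c * d + 1) ≤ 1) (hd0 : 0 ≤ d)
    (hS : S ≤ 16 * d) (hea0 : 0 ≤ ea) (hea : ea ≤ 3) : c * α * S * (ea + 1) ≤ 1 / 2 := by
  have h1 : c * α * S * (ea + 1) ≤ c * α * (16 * d) * 4 :=
    mul_le_mul (mul_le_mul_of_nonneg_left hS (mul_nonneg hc0 hα)) (by linarith) (by linarith) (by positivity)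
  have h2 : c * α * d ≤ 1 / 128 := by nlinarith [mul_nonneg (mul_nonneg hc0 hα) hd0]
  linarith

/-- arithmetic of `A_H ≤ A_H⋆` (outside the big context). [folklore] -/
private theorem AH_le {SH d Θg c α li E S ea : ℝ} (hd0 : 0 ≤ d) (hΘg : 0 ≤ Θg) (hc0 : 0 ≤ c) (hα : 0 ≤ α) (hα1 : α ≤ 1) (hli0 : 0 ≤ li) (hli : li ≤ 2)
    (hE0 : 0 ≤ E) {E' : ℝ} (hE : E ≤ E') (hS0 : 0 ≤ S) (hS : S ≤ 16 * d) (hea0 : 0 ≤ ea) (hea : ea ≤ 3) :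
    2 * (SH + d * ((Θg + c * α * li) * E) * (d * ((c * α) ^ 2 * ea + c * α) * S + c * α * d * ea)) ≤
      2 * (SH + d * ((Θg + 2 * c) * E') * (d * (3 * c ^ 2 + c) * (16 * d) + 3 * c * d)) := by
  have hcα0 : 0 ≤ c * α := mul_nonneg hc0 hα
  have hcα1 : c * α ≤ c := (mul_le_mul_of_nonneg_left hα1 hc0).trans_eq (mul_one c)
  have h1 : Θg + c * α * li ≤ Θg + 2 * c := by nlinarith
  have hE'0 : 0 ≤ E' := hE0.trans hE
  have h2 : (Θg + c * α * li) * E ≤ (Θg + 2 * c) * E' := mul_le_mul h1 hE hE0 (by positivity)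
  have h3 : (c * α) ^ 2 * ea + c * α ≤ 3 * c ^ 2 + c := by
    have : (c * α) ^ 2 ≤ c ^ 2 := pow_le_pow_left₀ hcα0 hcα1 2
    nlinarith
  have h4 : d * ((c * α) ^ 2 * ea + c * α) * S ≤ d * (3 * c ^ 2 + c) * (16 * d) :=
    mul_le_mul (mul_le_mul_of_nonneg_left h3 hd0) hS hS0 (by positivity)
  have h5 : c * α * d * ea ≤ 3 * c * d := by
    calc c * α * d * ea = (c * α) * (d * ea) := by ring
      _ ≤ c * (d * 3) := mul_le_mul hcα1 (mul_le_mul_of_nonneg_left hea hd0) (by positivity) hc0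
      _ = 3 * c * d := by ring
  have h6 := mul_le_mul (mul_le_mul_of_nonneg_left h2 hd0) (add_le_add h4 h5) (by positivity) (by positivity)
  linarith


/-- the rate `a = min(a⋆, κ∕(d t))`: window, size and block-rate letters (outside the big context). [folklore] -/
private theorem rate_letters {d t as κ : ℝ} (hd1 : 1 ≤ d) (ht : 0 < t) (has0 : 0 < as) (has1 : as ≤ 1) (hκ : 0 < κ)
    (hlams : 1 / 2 ≤ 1 - 2 * d * t ^ 2 * (Real.cosh as - 1)) (hasq : as ^ 2 = 1 / (4 * d * t ^ 2 + 1)) (haKs : Real.sqrt (1 / (4 * d + 1)) ≤ as * t) :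
    ∃ a : ℝ, 0 ≤ a ∧ a ≤ 1 ∧ a * t ≤ 1 ∧ 1 / 2 ≤ 1 - 2 * d * t ^ 2 * (Real.cosh a - 1) ∧ a * d * t ≤ κ ∧
      min (Real.sqrt (1 / (4 * d + 1))) (κ / d) ≤ a * t := by
  have hd0 : 0 < d := by linarith
  have ha0 : 0 ≤ min as (κ / (d * t)) := le_min has0.le (by positivity)
  have haas : min as (κ / (d * t)) ≤ as := min_le_left _ _
  have hats : as * t ≤ 1 := by
    have h2 : (as * t) ^ 2 ≤ 1 := by
      rw [mul_pow, hasq, div_mul_eq_mul_div, one_mul, div_le_one (by positivity)]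
      nlinarith [sq_nonneg t, mul_le_mul_of_nonneg_right hd1 (sq_nonneg t)]
    nlinarith [mul_nonneg has0.le ht.le]
  have hcosh : Real.cosh (min as (κ / (d * t))) ≤ Real.cosh as := by
    rw [Real.cosh_le_cosh, abs_of_nonneg ha0, abs_of_nonneg has0.le]; exact haas
  refine ⟨min as (κ / (d * t)), ha0, haas.trans has1, (mul_le_mul_of_nonneg_right haas ht.le).trans hats, ?_, ?_, ?_⟩
  · nlinarith [mul_nonneg (mul_nonneg (by norm_num : (0:ℝ) ≤ 2) hd0.le) (sq_nonneg t)]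
  · calc min as (κ / (d * t)) * d * t ≤ (κ / (d * t)) * d * t := by gcongr; exact min_le_right _ _
      _ = κ := by field_simp
  · rw [min_mul_of_nonneg _ _ ht.le]
    exact min_le_min haKs (le_of_eq (by field_simp))

variable {d : ℕ} (L : ℕ) [NeZero L] (hL3 : 3 ≤ L)
  {𝔸 : Type*} [NormedRing 𝔸] [NormedAlgebra ℂ 𝔸] [CompleteSpace 𝔸] [NormOneClass 𝔸] [StarRing 𝔸]
  {W : Type*} [NormedAddCommGroup W] [InnerProductSpace ℂ W] [FiniteDimensional ℂ W] (φ : W ≃ₗ[ℂ] 𝔸)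
  {a' Mφ Mφ' : ℝ} (hMφ : 0 ≤ Mφ) (hMφ' : 0 ≤ Mφ') (hφ : ∀ w, ‖φ w‖ ≤ Mφ * ‖w‖) (hφ' : ∀ X, ‖φ.symm X‖ ≤ Mφ' * ‖X‖) (ha' : 0 < a')
  {r : ℝ} (hr0 : 0 ≤ r) (hr1 : r < 1)
  (τ : 𝔸 →ₗ[ℂ] ℂ) (hτ₂ : ∀ X Y : 𝔸, τ (X * Y) = τ (Y * X)) (hφτ : ∀ X Y : 𝔸, ⟪φ.symm X, φ.symm Y⟫_ℂ = τ (star X * Y))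

include hL3 hMφ hMφ' hφ hφ' ha' hr0 hr1 hτ₂ hφτ in
/-- **THE η-SCALE HÖLDER ROW WITH DECAY OF `(Δ^η_U + 1)⁻¹D*_U` ON THE MODEL, MODULO THE FLAT TWO-POINT LETTER.**  For `1 ≤ d`, `L ≥ 3`, `0 < β ≤ 1`, `SH ≥ 0` and the flat
letter `HflatT` (every height, period, rate `0 ≤ a` with `aL^{n+1} ≤ 1`, centre: the two-point row of the FLAT resolvent's adjoint with constant `SH`): `∃ αh Bh δh` such that
for every background of the model with its level letters, any positivity witnesses, every block-supported bond datum `‖f‖ ≤ F` and sites with `d(x,x′) ≤ L^{n+1}`: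
`‖((Δ^η_U+1)⁻¹D*_Uf)(x′) − ((Δ^η_U+1)⁻¹D*_Uf)(x)‖ ≤ Bh·e^{−δh·d_m(Πx, v)}·(d(x,x′)∕L^{n+1})^β·F`.
[cite: Balaban1985BackgroundPropagators, Thm 3.1 (3.43) p.398, (3.40) p.397, (3.42) p.397, (3.23) p.394] -/
theorem exists_holderRow_resolvent_covDiv_of_flat (hd : 1 ≤ d) {β : ℝ} (hβ0 : 0 < β) (hβ1 : β ≤ 1) (SH : ℝ) (hSH : 0 ≤ SH)
    (HflatT : ∀ (n : ℕ) (η : ℝ), η * (L : ℝ) ^ (n + 1) = 1 → ∀ (c₀ : ℝ) [Fact (0 < c₀)] (m : Fin d → ℕ) [∀ i, NeZero (m i)] (a : ℝ), 0 ≤ a →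
      a * (L : ℝ) ^ (n + 1) ≤ 1 → ∀ (x₀ : TSite d (towerP L m (n + 1))) (u : SiteL2K ℂ d (towerP L m (n + 1)) c₀ W) (f : BondL2K ℂ d (towerP L m (n + 1)) c₀ W) (F : ℝ),
      0 ≤ F → covLaplaceSiteK ((η⁻¹ : ℝ) : ℂ) (fun _ : Bond d (towerP L m (n + 1)) => (LinearMap.id : W →ₗ[ℂ] W)) (fun _ => LinearMap.id) u + ((1 : ℝ) : ℂ) • u =
        covDivL2K ℂ c₀ ((η⁻¹ : ℝ) : ℂ) (fun _ : Bond d (towerP L m (n + 1)) => (LinearMap.id : W →ₗ[ℂ] W)) f →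
      (∀ b, ‖WL2.equiv ℂ (fun _ : Bond d (towerP L m (n + 1)) => c₀) W f b‖ ≤ F * ∏ μ, Real.cosh (a * (circAbs (towerP L m (n + 1) μ) ((((x₀ μ : ℕ) : ZMod (towerP L m (n + 1) μ)) - ((bpos b μ : ℕ) : ZMod (towerP L m (n + 1) μ))).val) : ℝ))) →
      ∀ x x', tdist (towerP L m (n + 1)) x x' ≤ (L : ℝ) ^ (n + 1) →
        ‖WL2.equiv ℂ (fun _ : TSite d (towerP L m (n + 1)) => c₀) W u x' - WL2.equiv ℂ (fun _ : TSite d (towerP L m (n + 1)) => c₀) W u x‖ ≤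
          SH * F * (tdist (towerP L m (n + 1)) x x' / (L : ℝ) ^ (n + 1)) ^ β * ∏ μ, Real.cosh (a * (circAbs (towerP L m (n + 1) μ) ((((x₀ μ : ℕ) : ZMod (towerP L m (n + 1) μ)) - ((x μ : ℕ) : ZMod (towerP L m (n + 1) μ))).val) : ℝ))) :
    ∃ αh Bh δh : ℝ, 0 < αh ∧ 0 ≤ Bh ∧ 0 < δh ∧
      ∀ (n : ℕ) (η : ℝ), η * (L : ℝ) ^ (n + 1) = 1 →
      ∀ (c₀ c₁ : ℝ) [Fact (0 < c₀)] [Fact (0 < c₁)], c₀ * ((L : ℝ) ^ (n + 1)) ^ d = c₁ →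
      ∀ (m : Fin d → ℕ) [∀ i, NeZero (m i)] (U : Bond d (towerP L m (n + 1)) → 𝔸ˣ),
      ∀ (α : ℝ), 0 ≤ α → α ≤ αh → (∀ b, U b ∈ U1 𝔸) → (∀ b, ‖(U b : 𝔸) - 1‖ ≤ α * η) →
        (∀ (x : TSite d (towerP L m (n + 1))) (μ : Fin d), ‖(U (x, μ) : 𝔸) - U (unshift μ x, μ)‖ ≤ α * η ^ 2) →
      ∀ (εU : ℕ → ℝ), (∀ j, 0 ≤ εU j) → (∀ j < n + 1, εU j ≤ α * r ^ j) →
        (∀ (j : ℕ) (b : Bond d (towerP L m (j + 1))), ‖(UlevOf L m (n + 1) U j b : 𝔸) - 1‖ ≤ εU j) →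
        (∀ (j : ℕ) (b : Bond d (towerP L m (j + 1))), UlevOf L m (n + 1) U j b ∈ U1 𝔸) →
        ∀ (hUst : ∀ b, star (U b : 𝔸) = ((U b)⁻¹ : 𝔸ˣ)),
        (∀ (j : ℕ) (b : Bond d (towerP L m (j + 1))) (w : W), ‖adTransportW φ (UlevOf L m (n + 1) U j) b w‖ ≤ ‖w‖) →
      ∀ (hpos' : ∀ x : SiteL2K ℂ d (towerP L m (n + 1)) c₀ W, x ≠ 0 → 0 < RCLike.re ⟪x, laplacePrimeAk L m n φ η U a' (c₁ := c₁) x⟫_ℂ)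
        (hpos₁ : ∀ x : SiteL2K ℂ d (towerP L m (n + 1)) c₀ W, x ≠ 0 →
          0 < RCLike.re ⟪x, ((covLaplaceSiteK (c₀ := c₀) ((η : ℂ))⁻¹ (adTransportW φ U) (adTransportW φ fun b => (U b)⁻¹) + (1 : ℂ) • LinearMap.id :
            SiteL2K ℂ d (towerP L m (n + 1)) c₀ W →ₗ[ℂ] SiteL2K ℂ d (towerP L m (n + 1)) c₀ W)) x⟫_ℂ)
        (v : TSite d m) (f : BondL2K ℂ d (towerP L m (n + 1)) c₀ W) (F : ℝ), 0 ≤ F →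
        (∀ b, blockCoord (L ^ (n + 1)) m (siteCast (towerP_eq_fineP_pow L m (n + 1)) (bpos b)) ≠ v →
          WL2.equiv ℂ (fun _ : Bond d (towerP L m (n + 1)) => c₀) W f b = 0) →
        (∀ b, ‖WL2.equiv ℂ (fun _ : Bond d (towerP L m (n + 1)) => c₀) W f b‖ ≤ F) →
      ∀ x x' : TSite d (towerP L m (n + 1)), tdist (towerP L m (n + 1)) x x' ≤ (L : ℝ) ^ (n + 1) →
        ‖WL2.equiv ℂ (fun _ : TSite d (towerP L m (n + 1)) => c₀) W (greenK _ hpos₁ (covDivL2K ℂ c₀ ((η : ℂ))⁻¹ (adTransportW φ fun b => (U b)⁻¹) f)) x' -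
          WL2.equiv ℂ (fun _ : TSite d (towerP L m (n + 1)) => c₀) W (greenK _ hpos₁ (covDivL2K ℂ c₀ ((η : ℂ))⁻¹ (adTransportW φ fun b => (U b)⁻¹) f)) x‖ ≤
          Bh * Real.exp (-(δh * tdist m (blockCoord (L ^ (n + 1)) m (siteCast (towerP_eq_fineP_pow L m (n + 1)) x)) v)) *
            (tdist (towerP L m (n + 1)) x x' / (L : ℝ) ^ (n + 1)) ^ β * F := by
  -- the gradient letter and the constants
  obtain ⟨αg, Θg, κg, hαg, hΘg, hκg, HG⟩ := exists_gradLetter_resolvent L hL3 φ hMφ hMφ' hφ hφ' ha' hr0 hr1 τ hτ₂ hφτ hd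
  obtain ⟨c, hc⟩ : ∃ c : ℝ, c = 2 * Mφ * Mφ' := ⟨_, rfl⟩
  have hc0 : 0 ≤ c := by rw [hc]; positivity
  have hd0 : (0 : ℝ) ≤ d := Nat.cast_nonneg d
  obtain ⟨AHs, hAHs⟩ : ∃ A : ℝ, A = 2 * (SH + d * ((Θg + 2 * c) * Real.exp (2 * κg)) * (d * (3 * c ^ 2 + c) * (16 * d) + 3 * c * d)) := ⟨_, rfl⟩
  have hAHs0 : 0 ≤ AHs := by rw [hAHs]; positivity
  refine ⟨min (1 / (128 * c * d + 1)) αg, 6 * AHs, min (Real.sqrt (1 / (4 * d + 1))) (κg / d), lt_min (by positivity) hαg, by positivity,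
    lt_min (Real.sqrt_pos.2 (by positivity)) (by positivity), ?_⟩
  intro n η hηL c₀ c₁ _ _ hw m _ U α hα hαle hUb hUη hUgrad εU hεU hεg hUε hLb hUst hRlev hpos' hpos₁ v f F hF hfv hfF x x' hxx
  have hαle1 : α ≤ 1 / (128 * c * d + 1) := hαle.trans (min_le_left _ _)
  have hαg' : α ≤ αg := hαle.trans (min_le_right _ _)
  -- the scale letters
  have hK1 : (1 : ℝ) ≤ (L : ℝ) ^ (n + 1) := one_le_pow₀ (by exact_mod_cast (by omega : 1 ≤ L))
  have hK0 : (0 : ℝ) < (L : ℝ) ^ (n + 1) := lt_of_lt_of_le one_pos hK1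
  have hη0 : 0 < η := by nlinarith only [hηL, hK0]
  have hηK : η⁻¹ = (L : ℝ) ^ (n + 1) := inv_eq_of_mul_eq_one_right hηL
  have hηt : η * η⁻¹ = 1 := mul_inv_cancel₀ hη0.ne'
  have hm1 : ∀ i, 1 ≤ m i := fun i => Nat.one_le_iff_ne_zero.mpr (NeZero.ne (m i))
  have hP : ∀ ν : Fin d, η⁻¹ ≤ (towerP L m (n + 1) ν : ℝ) := fun ν => by
    rw [hηK, towerP_apply, Nat.cast_mul, Nat.cast_pow]
    exact le_mul_of_one_le_right hK0.le (by exact_mod_cast hm1 ν)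
  have hn2 : ∀ ν : Fin d, 2 ≤ towerP L m (n + 1) ν := fun ν => by
    rw [towerP_apply]
    calc 2 ≤ L ^ 1 * 1 := by rw [pow_one, mul_one]; omega
      _ ≤ L ^ (n + 1) * m ν := Nat.mul_le_mul (Nat.pow_le_pow_right (by omega) (by omega)) (hm1 ν)

  -- the rate `a = min(a⋆, κg/(dK))`
  obtain ⟨ha0s, ha1s, hlams, haKs⟩ := rate_explicit (d := d) η⁻¹ 1 one_pos (by rw [hηK]; exact hK1)
  have hd1 : (1 : ℝ) ≤ d := by exact_mod_cast hd
  have hηi0 : 0 < η⁻¹ := inv_pos.2 hη0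
  have hasq : Real.sqrt (1 / (4 * d * η⁻¹ ^ 2 + 1)) ^ 2 = 1 / (4 * d * η⁻¹ ^ 2 + 1) := Real.sq_sqrt (by positivity)
  obtain ⟨a, ha0, ha1, hat, hlam, haκ', hδ'⟩ := rate_letters (κ := κg) hd1 hηi0 ha0s ha1s hκg hlams hasq haKs
  have hlam' : 2 * (d : ℝ) * η⁻¹ ^ 2 * (Real.cosh a - 1) < 1 := by linarith only [hlam]
  have hlamh : 2 * (d : ℝ) * η⁻¹ ^ 2 * (Real.cosh a - 1) ≤ 1 / 2 := by linarith only [hlam]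
  have haκ : a * d * (L : ℝ) ^ (n + 1) ≤ κg := by rw [← hηK]; exact haκ'
  have hea : Real.exp a ≤ 3 := (Real.exp_le_exp.2 ha1).trans (by have := Real.exp_one_lt_d9; linarith only [this])
  have haK1 : a * (L : ℝ) ^ (n + 1) ≤ 1 := by rw [← hηK]; exact hat
  have hδ : min (Real.sqrt (1 / (4 * d + 1))) (κg / d) ≤ a * (L : ℝ) ^ (n + 1) := by rw [← hηK]; exact hδ'
  -- the transporter letters
  have hUbinv : ∀ b, (U b)⁻¹ ∈ U1 𝔸 := fun b => by
    have h := mem_U1.1 (hUb b); rw [mem_U1, inv_inv]; exact ⟨h.2, h.1⟩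
  have hRε : ∀ b w, ‖adTransportW φ U b w - w‖ ≤ c * (α * η) * ‖w‖ := fun b w => by
    have h := norm_adTransportW_sub_le φ hφ hφ' hMφ' U b (hUb b) (hUη b) w; rw [hc]; linarith only [h]
  have hSε : ∀ b w, ‖adTransportW φ (fun bb => (U bb)⁻¹) b w - w‖ ≤ c * (α * η) * ‖w‖ := fun b w => by
    have h := norm_adTransportW_sub_le φ hφ hφ' hMφ' (fun bb => (U bb)⁻¹) b (hUbinv b) ((norm_inv_sub_one_le (hUb b)).trans (hUη b)) w
    rw [hc]; linarith only [h]
  have hSε' : ∀ (y : TSite d (towerP L m (n + 1))) (μ : Fin d) (w : W),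
      ‖adTransportW φ (fun bb => (U bb)⁻¹) (y, μ) w - adTransportW φ (fun bb => (U bb)⁻¹) (unshift μ y, μ) w‖ ≤ c * (α * η ^ 2) * ‖w‖ := fun y μ w => by
    have h := norm_adTransportW_inv_sub_adTransportW_inv_le φ hφ hφ' hMφ' U U (y, μ) (unshift μ y, μ) (hUb _) (hUb _) w
    have h2 : 2 * Mφ * Mφ' * ‖(U (y, μ) : 𝔸) - (U (unshift μ y, μ) : 𝔸)‖ * ‖w‖ ≤ c * (α * η ^ 2) * ‖w‖ := by
      rw [hc]; exact mul_le_mul_of_nonneg_right (mul_le_mul_of_nonneg_left (hUgrad y μ) (by positivity)) (norm_nonneg w)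
    exact h.trans h2
  -- the flat constant and the uniform bounds (scalars only)
  have hSad := sad_le_sixteen_mul (towerP L m (n + 1)) (t := η⁻¹) (a := a) (by rw [hηK]; exact hK1) ha0 ha1 hat hlam hP
  have hSad0 := B9Eq342CovariantResolventAdjointRow.sad_nonneg (P := towerP L m (n + 1)) η⁻¹ (inv_pos.2 hη0) (m := 1) ha0 hlam' _ rfl
  have htε : η⁻¹ * (c * (α * η)) = c * α := by field_simp
  have htε' : η⁻¹ ^ 2 * (c * (α * η ^ 2)) = c * α := by field_simp
  have hα1 : α * (128 * c * d + 1) ≤ 1 := (le_div_iff₀ (by positivity)).1 hαle1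
  have hαa1 : α ≤ 1 := by nlinarith only [hα1, mul_nonneg (mul_nonneg hα hc0) hd0]
  have hκ : η⁻¹ * (c * (α * η)) * (η⁻¹ * ∑ ν : Fin d, ((1 + Real.exp (-a)) * ((1 + 2 * η⁻¹ / (towerP L m (n + 1) ν * Real.sqrt (1 - 2 * ((d : ℝ) - 1) * η⁻¹ ^ 2 * (Real.cosh a - 1)))) /
            Real.sqrt ((1 - 2 * ((d : ℝ) - 1) * η⁻¹ ^ 2 * (Real.cosh a - 1)) ^ 2 + 4 * (1 - 2 * ((d : ℝ) - 1) * η⁻¹ ^ 2 * (Real.cosh a - 1)) * η⁻¹ ^ 2)) +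
          2 * Real.sinh a / (1 - 2 * (d : ℝ) * η⁻¹ ^ 2 * (Real.cosh a - 1)))) * (Real.exp a + 1) ≤ 1 / 2 := by
    rw [htε]; exact kappa_le_half hc0 hα hα1 hd0 hSad (Real.exp_pos a).le hea
  have hlam2 : (1 - 2 * (d : ℝ) * η⁻¹ ^ 2 * (Real.cosh a - 1))⁻¹ ≤ 2 := by
    rw [inv_le_comm₀ (by linarith only [hlam']) two_pos]; linarith only [hlam]
  have hE : Real.exp (a * d * (η⁻¹ + 1)) ≤ Real.exp (2 * κg) := Real.exp_le_exp.2 (by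
    rw [hηK]; nlinarith only [mul_le_mul_of_nonneg_left hK1 (mul_nonneg ha0 hd0), haκ])
  have hAH : 2 * (SH + d * (L : ℝ) ^ (n + 1) * ((η⁻¹⁻¹ * Θg + c * (α * η) * (1 - 2 * (d : ℝ) * η⁻¹ ^ 2 * (Real.cosh a - 1))⁻¹) * Real.exp (a * d * ((L : ℝ) ^ (n + 1) + 1))) *
      (η⁻¹ ^ 2 * d * ((c * (α * η)) ^ 2 * Real.exp a + c * (α * η ^ 2)) * (η⁻¹ * ∑ ν : Fin d, ((1 + Real.exp (-a)) * ((1 + 2 * η⁻¹ / (towerP L m (n + 1) ν * Real.sqrt (1 - 2 * ((d : ℝ) - 1) * η⁻¹ ^ 2 * (Real.cosh a - 1)))) /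
            Real.sqrt ((1 - 2 * ((d : ℝ) - 1) * η⁻¹ ^ 2 * (Real.cosh a - 1)) ^ 2 + 4 * (1 - 2 * ((d : ℝ) - 1) * η⁻¹ ^ 2 * (Real.cosh a - 1)) * η⁻¹ ^ 2)) +
          2 * Real.sinh a / (1 - 2 * (d : ℝ) * η⁻¹ ^ 2 * (Real.cosh a - 1)))) + η⁻¹ * (c * (α * η)) * d * Real.exp a)) ≤ AHs := by
    rw [← hηK]
    have e1 : d * η⁻¹ * ((η⁻¹⁻¹ * Θg + c * (α * η) * (1 - 2 * (d : ℝ) * η⁻¹ ^ 2 * (Real.cosh a - 1))⁻¹) * Real.exp (a * d * (η⁻¹ + 1))) =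
        d * ((Θg + c * α * (1 - 2 * (d : ℝ) * η⁻¹ ^ 2 * (Real.cosh a - 1))⁻¹) * Real.exp (a * d * (η⁻¹ + 1))) := by
      field_simp
    have e2 : η⁻¹ ^ 2 * d * ((c * (α * η)) ^ 2 * Real.exp a + c * (α * η ^ 2)) * (η⁻¹ * ∑ ν : Fin d, ((1 + Real.exp (-a)) * ((1 + 2 * η⁻¹ / (towerP L m (n + 1) ν * Real.sqrt (1 - 2 * ((d : ℝ) - 1) * η⁻¹ ^ 2 * (Real.cosh a - 1)))) /
            Real.sqrt ((1 - 2 * ((d : ℝ) - 1) * η⁻¹ ^ 2 * (Real.cosh a - 1)) ^ 2 + 4 * (1 - 2 * ((d : ℝ) - 1) * η⁻¹ ^ 2 * (Real.cosh a - 1)) * η⁻¹ ^ 2)) +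
          2 * Real.sinh a / (1 - 2 * (d : ℝ) * η⁻¹ ^ 2 * (Real.cosh a - 1)))) + η⁻¹ * (c * (α * η)) * d * Real.exp a =
        d * ((c * α) ^ 2 * Real.exp a + c * α) * (η⁻¹ * ∑ ν : Fin d, ((1 + Real.exp (-a)) * ((1 + 2 * η⁻¹ / (towerP L m (n + 1) ν * Real.sqrt (1 - 2 * ((d : ℝ) - 1) * η⁻¹ ^ 2 * (Real.cosh a - 1)))) /
            Real.sqrt ((1 - 2 * ((d : ℝ) - 1) * η⁻¹ ^ 2 * (Real.cosh a - 1)) ^ 2 + 4 * (1 - 2 * ((d : ℝ) - 1) * η⁻¹ ^ 2 * (Real.cosh a - 1)) * η⁻¹ ^ 2)) +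
          2 * Real.sinh a / (1 - 2 * (d : ℝ) * η⁻¹ ^ 2 * (Real.cosh a - 1)))) + c * α * d * Real.exp a := by
      have h1 : η⁻¹ ^ 2 * (c * (α * η)) ^ 2 = (c * α) ^ 2 := by rw [← htε]; ring
      calc _ = d * ((η⁻¹ ^ 2 * (c * (α * η)) ^ 2) * Real.exp a + η⁻¹ ^ 2 * (c * (α * η ^ 2))) * (η⁻¹ * ∑ ν : Fin d, ((1 + Real.exp (-a)) * ((1 + 2 * η⁻¹ / (towerP L m (n + 1) ν * Real.sqrt (1 - 2 * ((d : ℝ) - 1) * η⁻¹ ^ 2 * (Real.cosh a - 1)))) /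
            Real.sqrt ((1 - 2 * ((d : ℝ) - 1) * η⁻¹ ^ 2 * (Real.cosh a - 1)) ^ 2 + 4 * (1 - 2 * ((d : ℝ) - 1) * η⁻¹ ^ 2 * (Real.cosh a - 1)) * η⁻¹ ^ 2)) +
          2 * Real.sinh a / (1 - 2 * (d : ℝ) * η⁻¹ ^ 2 * (Real.cosh a - 1)))) + (η⁻¹ * (c * (α * η))) * d * Real.exp a := by ring
        _ = _ := by rw [h1, htε', htε]
    rw [e1, e2, hAHs]
    exact AH_le hd0 hΘg hc0 hα hαa1 (by positivity) hlam2 (Real.exp_pos _).le hE hSad0 hSad (Real.exp_pos a).le hea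
  -- the data in the weighted currency centred at `x`
  set D : ℝ := tdist m (blockCoord (L ^ (n + 1)) m (siteCast (towerP_eq_fineP_pow L m (n + 1)) x)) v with hD
  have hD0 : 0 ≤ D := tdist_nonneg m _ _
  obtain ⟨Fx, hFx⟩ : ∃ Fx : ℝ, Fx = 2 * Real.exp (a * ((L : ℝ) ^ (n + 1) - 1)) * Real.exp (-(a * (L : ℝ) ^ (n + 1) * D)) * F := ⟨_, rfl⟩
  have hFx0 : 0 ≤ Fx := by rw [hFx]; positivity
  have hdata : ∀ b : Bond d (towerP L m (n + 1)), ‖WL2.equiv ℂ _ W f b‖ ≤ Fx * ∏ μ, Real.cosh (a * (circAbs (towerP L m (n + 1) μ) ((((x μ : ℕ) : ZMod (towerP L m (n + 1) μ)) - ((bpos b μ : ℕ) : ZMod (towerP L m (n + 1) μ))).val) : ℝ)) := fun b => by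
    by_cases hb : blockCoord (L ^ (n + 1)) m (siteCast (towerP_eq_fineP_pow L m (n + 1)) (bpos b)) = v
    · have hW := exp_bigBlockDist_le_weight_site L m n ha0 x (bpos b)
      rw [hb, ← hD] at hW
      refine (hfF b).trans ?_
      have hpos3 : 0 < Real.exp (a * ((L : ℝ) ^ (n + 1) - 1)) * 2 := by positivity
      calc F = Fx * (Real.exp (a * (L : ℝ) ^ (n + 1) * D) / (Real.exp (a * ((L : ℝ) ^ (n + 1) - 1)) * 2)) := by
            rw [hFx, Real.exp_neg]; field_simp
        _ ≤ Fx * _ := mul_le_mul_of_nonneg_left ((div_le_iff₀' hpos3).2 hW) hFx0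
    · rw [hfv b hb, norm_zero]; positivity
  have hexp1 : Real.exp (a * ((L : ℝ) ^ (n + 1) - 1)) ≤ 3 := by
    have h1 : a * ((L : ℝ) ^ (n + 1) - 1) ≤ 1 := by nlinarith only [ha0, haK1]
    exact (Real.exp_le_exp.2 h1).trans (by have := Real.exp_one_lt_d9; linarith only [this])
  have hexp2 : Real.exp (-(a * (L : ℝ) ^ (n + 1) * D)) ≤ Real.exp (-(min (Real.sqrt (1 / (4 * d + 1))) (κg / d) * D)) := by
    rw [Real.exp_le_exp, neg_le_neg_iff]; exact mul_le_mul_of_nonneg_right hδ hD0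
  set ρ : ℝ := (tdist (towerP L m (n + 1)) x x' / (L : ℝ) ^ (n + 1)) ^ β with hρ
  have hρ0 : 0 ≤ ρ := Real.rpow_nonneg (div_nonneg (tdist_nonneg _ _ _) hK0.le) β
  have hfin : AHs * Fx * ρ ≤ 6 * AHs * Real.exp (-(min (Real.sqrt (1 / (4 * d + 1))) (κg / d) * D)) * ρ * F := by
    rw [hFx]
    calc AHs * (2 * Real.exp (a * ((L : ℝ) ^ (n + 1) - 1)) * Real.exp (-(a * (L : ℝ) ^ (n + 1) * D)) * F) * ρ
        = AHs * 2 * F * ρ * (Real.exp (a * ((L : ℝ) ^ (n + 1) - 1)) * Real.exp (-(a * (L : ℝ) ^ (n + 1) * D))) := by ring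
      _ ≤ AHs * 2 * F * ρ * (3 * Real.exp (-(min (Real.sqrt (1 / (4 * d + 1))) (κg / d) * D))) :=
          mul_le_mul_of_nonneg_left (mul_le_mul hexp1 hexp2 (Real.exp_pos _).le (by norm_num)) (by positivity)
      _ = _ := by ring
  -- THE ABSTRACT HÖLDER ROW, instantiated (centre := `x`, `ℓ := L^{n+1} = η⁻¹`)
  have hmain := holderAdjRow_covariantResolvent_half (P := towerP L m (n + 1)) (c₀ := c₀) (W := W) η⁻¹ (inv_pos.2 hη0) (m := 1) (a := a)
    (ε := c * (α * η)) (ε' := c * (α * η ^ 2)) (ℓ := (L : ℝ) ^ (n + 1)) (β := β) one_pos ha0 (by positivity) (by positivity) hK0 hβ0 hβ1 hlam' hn2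
    (adTransportW φ U) (adTransportW φ fun b => (U b)⁻¹) (fun b w => adTransportW_inv_adTransportW φ U b w)
    (fun b w => (norm_adTransportW_eq φ U τ hτ₂ hUst hφτ b w).le) (fun b w => (norm_adTransportW_inv_eq φ U τ hτ₂ hUst hφτ b w).le)
    hRε hSε hSε'
    (fun x₀ y => ∏ μ, Real.cosh (a * (circAbs (towerP L m (n + 1) μ)
      ((((x₀ μ : ℕ) : ZMod (towerP L m (n + 1) μ)) - ((y μ : ℕ) : ZMod (towerP L m (n + 1) μ))).val) : ℝ))) (fun _ _ => rfl) _ rfl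
    ((covLaplaceSiteK (c₀ := c₀) ((η : ℂ))⁻¹ (adTransportW φ U) (adTransportW φ fun b => (U b)⁻¹) + (1 : ℂ) • LinearMap.id :
      SiteL2K ℂ d (towerP L m (n + 1)) c₀ W →ₗ[ℂ] SiteL2K ℂ d (towerP L m (n + 1)) c₀ W))
    (by rw [Complex.ofReal_inv, Complex.ofReal_one]) hpos₁ SH hSH
    (fun x₀ u g G hG hu hg y y' hyy => HflatT n η hηL c₀ m a ha0 haK1 x₀ u g G hG hu hg y y' hyy)
    Θg hΘg
    (fun x₀ g Gs hGs hg b => by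
      rw [Complex.ofReal_inv]
      exact HG n η hηL c₀ c₁ hw m U α hα hαg' hUb hUη hUgrad εU hεU hεg hUε hLb hUst hRlev hpos' hpos₁ a ha0 haκ hlamh x₀ g Gs hGs hg b)
    hκ x f Fx hFx0 hdata x x' hxx
  rw [weight_site_centre (towerP L m (n + 1)) a x, mul_one, Complex.ofReal_inv] at hmain
  refine hmain.trans ?_
  calc _ ≤ AHs * Fx * ρ := by
        rw [hρ]; exact mul_le_mul_of_nonneg_right (mul_le_mul_of_nonneg_right hAH hFx0) hρ0
    _ ≤ _ := hfin

end Literature.MathematicalPhysics.QuantumFieldTheory.Balaban1983to89.B9Eq343ResolventHolderRowTowerOfFlat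

end
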